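import Mathlib

/-!
# `NewtonUnitEquationsNewtonTauWeakZeroSumFreeCard` — zero-sum-free exchanges are short (Steinitz bound)

Registered stub `stub_zeroSumFreeCard` of line `binomial-normal-form` (crux `NewtonTauWeak`,
stmt-ValiantsHypothesis-5904, lead c6), a piece of THEOREM W (hull vertices of `ℤ`-weighted level sets of
subset sums `{∑_J d_j : ∑_J g_j = v}`, `1 ≤ g_j ≤ c`): by the weighted exchange normal form a maximiser
differs from the density prefix by a removal family with weights `x_0, …, x_{p-1}` and an addition family
with weights `y_0, …, y_{m-1}`, all weights in `[1, c]`, with `∑ y = ∑ x + r` for a deficit `r < c`, and the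
pair is zero-sum-free: no nonempty subfamily of removals weighs the same as a subfamily of additions.  This
file is the counting fact that such a pair is short.

Claim.  Under these hypotheses `p + m ≤ 2 c`.

Proof (greedy Steinitz chain, knapsack proximity in dimension one).  Extend the weights by zero to
sequences `X, Y : ℕ → ℕ` and put `s (a, b) = ∑_{i<b} Y i - ∑_{i<a} X i ∈ ℤ`.  Walk from `(0, 0)` to
`(p, m)` in `p + m` unit steps, greedily: at a point with `s ≤ 0` add the next `y` (`b ↦ b + 1`) if one is
left and otherwise remove the next `x` (`a ↦ a + 1`); at a point with `s > 0` do the opposite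
(`ZeroSumFreeCardAux.chain_invariant`).  Every visited point satisfies `-c < s ≤ c`: a step moves `s` by a
weight in `[1, c]` towards the other side of `0`, except at the two boundaries, where
`s (a, m) = r + ∑_{a ≤ i < p} X i > 0` for `a < p` (so the case "`s ≤ 0` and no `y` left" does not occur)
and `s (p, b + 1) = r - ∑_{b < i < m} Y i ≤ r < c`.  The chain is monotone in both coordinates
(`ZeroSumFreeCardAux.chain_monotone`), so two visited points `(a, b) ≤ (a', b')` with equal `s` give
`∑_{a ≤ i < a'} X i = ∑_{b ≤ i < b'} Y i`; zero-sum-freeness forces `a = a'`, and then the right-hand side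
is a vanishing sum of `b' - b ≥ 1` positive weights, impossible (`ZeroSumFreeCardAux.chain_ne`).  Hence the
`p + m + 1` values of `s` along the chain are distinct integers of the interval `(-c, c]` of size `2 c`, so
`p + m + 1 ≤ 2 c` (`ZeroSumFreeCardAux.core_bound`, via `Finset.card_le_card_of_injOn`).  The main theorem
only translates the `Fin`-indexed data to sequences (`ZeroSumFreeCardAux.exists_extension`).
[folklore: Steinitz lemma in dimension one]
-/

-- Sub = Summit single-conjunct layout: the duplicated namespace component is mandated by the tree.
set_option linter.dupNamespace false

noncomputable section

open scoped BigOperators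

namespace Summit.ValiantsHypothesis.ValiantsHypothesis.Theorems.NewtonUnitEquationsNewtonTauWeak

namespace ZeroSumFreeCardAux

/-- Extension by zero of a `Fin p`-indexed weight vector to a sequence `X : ℕ → ℕ`: the weights keep their
bounds below `p`, the total sum is unchanged, and sums of `X` over integer intervals `[a, a')`, `a' ≤ p`,
are sums of the original weights over the corresponding sets of indices. [folklore] -/
theorem exists_extension (p c : ℕ) (x : Fin p → ℕ) (hx : ∀ i, 1 ≤ x i ∧ x i ≤ c) :
    ∃ X : ℕ → ℕ, (∀ i < p, 1 ≤ X i ∧ X i ≤ c) ∧ (∑ i ∈ Finset.range p, X i = ∑ i, x i) ∧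
      ∀ a a', a' ≤ p → ∑ i ∈ Finset.Ico a a', X i =
        ∑ i ∈ Finset.univ.filter (fun i : Fin p => a ≤ (i : ℕ) ∧ (i : ℕ) < a'), x i := by
  refine ⟨fun n => if h : n < p then x ⟨n, h⟩ else 0, fun i hi => ?_, ?_, fun a a' ha' => ?_⟩
  · simpa [hi] using hx ⟨i, hi⟩
  · rw [Finset.sum_range]
    exact Finset.sum_congr rfl fun i _ => by simp
  · have h1 : Finset.Ico a a' = (Finset.range p).filter (fun i => a ≤ i ∧ i < a') := by
      ext i
      simp only [Finset.mem_Ico, Finset.mem_filter, Finset.mem_range]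
      omega
    rw [Finset.sum_filter, h1, Finset.sum_filter, Finset.sum_range]
    exact Finset.sum_congr rfl fun i _ => by simp

/-- Adding the next `y`: `s (a, b + 1) = s (a, b) + Y b`. [folklore] -/
theorem s_succ_right {X Y : ℕ → ℕ} {S : ℕ → ℕ → ℤ}
    (hS : ∀ a b, S a b = ∑ i ∈ Finset.range b, (Y i : ℤ) - ∑ i ∈ Finset.range a, (X i : ℤ))
    (a b : ℕ) : S a (b + 1) = S a b + Y b := by
  rw [hS, hS, Finset.sum_range_succ]
  ring

/-- Removing the next `x`: `s (a + 1, b) = s (a, b) - X a`. [folklore] -/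
theorem s_succ_left {X Y : ℕ → ℕ} {S : ℕ → ℕ → ℤ}
    (hS : ∀ a b, S a b = ∑ i ∈ Finset.range b, (Y i : ℤ) - ∑ i ∈ Finset.range a, (X i : ℤ))
    (a b : ℕ) : S (a + 1) b = S a b - X a := by
  rw [hS, hS, Finset.sum_range_succ]
  ring

/-- Upper boundary of the box: once all `y` are added, `s (a, m) = r + ∑_{a ≤ i < p} X i`. [folklore] -/
theorem s_top {X Y : ℕ → ℕ} {S : ℕ → ℕ → ℤ} {p m r : ℕ}
    (hS : ∀ a b, S a b = ∑ i ∈ Finset.range b, (Y i : ℤ) - ∑ i ∈ Finset.range a, (X i : ℤ))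
    (hsum : ∑ i ∈ Finset.range m, Y i = ∑ i ∈ Finset.range p, X i + r) {a : ℕ} (ha : a ≤ p) :
    S a m = r + ∑ i ∈ Finset.Ico a p, (X i : ℤ) := by
  have h : ∑ i ∈ Finset.range m, (Y i : ℤ) =
      ∑ i ∈ Finset.range a, (X i : ℤ) + ∑ i ∈ Finset.Ico a p, (X i : ℤ) + r := by
    rw [Finset.sum_range_add_sum_Ico _ ha]
    exact_mod_cast hsum
  rw [hS, h]
  ring

/-- Right boundary of the box: once all `x` are removed, `s (p, b) = r - ∑_{b ≤ i < m} Y i`. [folklore] -/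
theorem s_right {X Y : ℕ → ℕ} {S : ℕ → ℕ → ℤ} {p m r : ℕ}
    (hS : ∀ a b, S a b = ∑ i ∈ Finset.range b, (Y i : ℤ) - ∑ i ∈ Finset.range a, (X i : ℤ))
    (hsum : ∑ i ∈ Finset.range m, Y i = ∑ i ∈ Finset.range p, X i + r) {b : ℕ} (hb : b ≤ m) :
    S p b = r - ∑ i ∈ Finset.Ico b m, (Y i : ℤ) := by
  have h : ∑ i ∈ Finset.range b, (Y i : ℤ) + ∑ i ∈ Finset.Ico b m, (Y i : ℤ) =
      ∑ i ∈ Finset.range p, (X i : ℤ) + r := by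
    rw [Finset.sum_range_add_sum_Ico _ hb]
    exact_mod_cast hsum
  rw [hS]
  linarith

/-- The greedy chain is monotone: each step raises one coordinate by one and keeps the other. [folklore] -/
theorem chain_monotone {S : ℕ → ℕ → ℤ} {p m : ℕ} {path : ℕ → ℕ × ℕ}
    (hstep : ∀ n, path (n + 1) =
      if S (path n).1 (path n).2 ≤ 0 then
        (if (path n).2 < m then ((path n).1, (path n).2 + 1) else ((path n).1 + 1, (path n).2))
      else (if (path n).1 < p then ((path n).1 + 1, (path n).2) else ((path n).1, (path n).2 + 1))) :
    Monotone path := by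
  refine monotone_nat_of_le_succ fun n => ?_
  rw [hstep n]
  split_ifs <;> exact Prod.le_def.mpr ⟨by simp, by simp⟩

/-- Invariant of the greedy chain: after `n ≤ p + m` steps it sits at a point `(a, b)` of the box
`[0, p] × [0, m]` with `a + b = n` and `-c < s (a, b) ≤ c`.  The inductive step is the case analysis of the
module docstring; the case "`s ≤ 0` and `b = m`" is excluded by `s (a, m) = r + ∑_{a ≤ i < p} X i > 0`, and
in the case "`s > 0` and `a = p`" the new value is `s (p, b + 1) = r - ∑_{b < i < m} Y i ≤ r < c`.
[folklore] -/
theorem chain_invariant {X Y : ℕ → ℕ} {S : ℕ → ℕ → ℤ} {p m c r : ℕ} {path : ℕ → ℕ × ℕ}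
    (hS : ∀ a b, S a b = ∑ i ∈ Finset.range b, (Y i : ℤ) - ∑ i ∈ Finset.range a, (X i : ℤ))
    (hX : ∀ i < p, 1 ≤ X i ∧ X i ≤ c) (hY : ∀ i < m, 1 ≤ Y i ∧ Y i ≤ c)
    (hsum : ∑ i ∈ Finset.range m, Y i = ∑ i ∈ Finset.range p, X i + r) (hr : r < c)
    (hpath0 : path 0 = (0, 0))
    (hstep : ∀ n, path (n + 1) =
      if S (path n).1 (path n).2 ≤ 0 then
        (if (path n).2 < m then ((path n).1, (path n).2 + 1) else ((path n).1 + 1, (path n).2))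
      else (if (path n).1 < p then ((path n).1 + 1, (path n).2) else ((path n).1, (path n).2 + 1)))
    (n : ℕ) (hn : n ≤ p + m) :
    (path n).1 + (path n).2 = n ∧ (path n).1 ≤ p ∧ (path n).2 ≤ m ∧
      -(c : ℤ) < S (path n).1 (path n).2 ∧ S (path n).1 (path n).2 ≤ c := by
  induction n with
  | zero =>
    have h0 : S 0 0 = 0 := by rw [hS]; simp
    rw [hpath0]
    show 0 + 0 = 0 ∧ 0 ≤ p ∧ 0 ≤ m ∧ -(c : ℤ) < S 0 0 ∧ S 0 0 ≤ c
    rw [h0]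
    omega
  | succ n ih =>
    obtain ⟨hab, ha, hb, hlo, hhi⟩ := ih (Nat.le_of_succ_le hn)
    by_cases hs : S (path n).1 (path n).2 ≤ 0
    · by_cases hbm : (path n).2 < m
      · -- add the next `y`
        have h1 := s_succ_right hS (path n).1 (path n).2
        have h2 := hY _ hbm
        rw [hstep n, if_pos hs, if_pos hbm]
        dsimp only
        refine ⟨by omega, ha, hbm, by omega, by omega⟩
      · -- no `y` left: `b = m`, `a < p`, and `s (a, m) > 0` contradicts `s ≤ 0`
        exfalso
        have hbm' : (path n).2 = m := le_antisymm hb (not_lt.mp hbm)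
        have hap : (path n).1 < p := by omega
        have h1 := s_top hS hsum hap.le
        have h2 : (X (path n).1 : ℤ) ≤ ∑ i ∈ Finset.Ico (path n).1 p, (X i : ℤ) :=
          Finset.single_le_sum (f := fun i => (X i : ℤ)) (fun i _ => by positivity)
            (Finset.mem_Ico.mpr ⟨le_rfl, hap⟩)
        have h3 := (hX _ hap).1
        rw [hbm'] at hs
        omega
    · by_cases hap : (path n).1 < p
      · -- remove the next `x`
        have h1 := s_succ_left hS (path n).1 (path n).2
        have h2 := hX _ hap
        rw [hstep n, if_neg hs, if_pos hap]
        dsimp only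
        refine ⟨by omega, hap, hb, by omega, by omega⟩
      · -- no `x` left: `a = p`, `b < m`, and the next value is `r - ∑_{b < i < m} Y i ∈ (0, r]`
        have hap' : (path n).1 = p := le_antisymm ha (not_lt.mp hap)
        have hbm : (path n).2 < m := by omega
        have h1 : S p ((path n).2 + 1) = r - ∑ i ∈ Finset.Ico ((path n).2 + 1) m, (Y i : ℤ) :=
          s_right hS hsum hbm
        have h2 : (0 : ℤ) ≤ ∑ i ∈ Finset.Ico ((path n).2 + 1) m, (Y i : ℤ) := by positivity
        have h3 := s_succ_right hS (path n).1 (path n).2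
        rw [hstep n, if_neg hs, if_neg hap]
        dsimp only
        rw [hap'] at hs h3 ⊢
        refine ⟨by omega, le_rfl, hbm, by omega, by omega⟩

/-- Two distinct points of the greedy chain carry distinct values of `s`: by monotonicity the later point
`(a', b')` dominates the earlier one `(a, b)`, and equality of `s` means `∑_{a ≤ i < a'} X i = ∑_{b ≤ i < b'} Y i`;
for `a < a'` this is excluded by zero-sum-freeness, and for `a = a'` (hence `b < b'`) the right-hand side is
a vanishing nonempty sum of positive weights. [folklore] -/
theorem chain_ne {X Y : ℕ → ℕ} {S : ℕ → ℕ → ℤ} {p m c r : ℕ} {path : ℕ → ℕ × ℕ}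
    (hS : ∀ a b, S a b = ∑ i ∈ Finset.range b, (Y i : ℤ) - ∑ i ∈ Finset.range a, (X i : ℤ))
    (hX : ∀ i < p, 1 ≤ X i ∧ X i ≤ c) (hY : ∀ i < m, 1 ≤ Y i ∧ Y i ≤ c)
    (hsum : ∑ i ∈ Finset.range m, Y i = ∑ i ∈ Finset.range p, X i + r) (hr : r < c)
    (hfree : ∀ a a' b b', a < a' → a' ≤ p → b ≤ b' → b' ≤ m →
      ∑ i ∈ Finset.Ico a a', X i ≠ ∑ i ∈ Finset.Ico b b', Y i)
    (hpath0 : path 0 = (0, 0))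
    (hstep : ∀ n, path (n + 1) =
      if S (path n).1 (path n).2 ≤ 0 then
        (if (path n).2 < m then ((path n).1, (path n).2 + 1) else ((path n).1 + 1, (path n).2))
      else (if (path n).1 < p then ((path n).1 + 1, (path n).2) else ((path n).1, (path n).2 + 1)))
    {n n' : ℕ} (hnn' : n < n') (hn' : n' ≤ p + m) :
    S (path n).1 (path n).2 ≠ S (path n').1 (path n').2 := by
  obtain ⟨hab, _, _, _, _⟩ := chain_invariant hS hX hY hsum hr hpath0 hstep n (hnn'.le.trans hn')
  obtain ⟨hab', ha', hb', _, _⟩ := chain_invariant hS hX hY hsum hr hpath0 hstep n' hn'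
  obtain ⟨haa, hbb⟩ := Prod.le_def.mp (chain_monotone hstep hnn'.le)
  intro heq
  rw [hS, hS] at heq
  have h1 : ∑ i ∈ Finset.Ico (path n).1 (path n').1, (X i : ℤ) =
      ∑ i ∈ Finset.Ico (path n).2 (path n').2, (Y i : ℤ) := by
    rw [Finset.sum_Ico_eq_sub _ haa, Finset.sum_Ico_eq_sub _ hbb]
    linarith
  have h2 : ∑ i ∈ Finset.Ico (path n).1 (path n').1, X i = ∑ i ∈ Finset.Ico (path n).2 (path n').2, Y i := by
    exact_mod_cast h1
  rcases haa.eq_or_lt with hEq | hlt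
  · -- same number of removals: `b < b'` and a nonempty sum of positive weights vanishes
    rw [← hEq, Finset.Ico_self, Finset.sum_empty] at h2
    have hbb' : (path n).2 < (path n').2 := by omega
    have h3 : Y (path n).2 ≤ ∑ i ∈ Finset.Ico (path n).2 (path n').2, Y i :=
      Finset.single_le_sum (fun i _ => Nat.zero_le _) (Finset.mem_Ico.mpr ⟨le_rfl, hbb'⟩)
    have h4 := (hY _ (hbb'.trans_le hb')).1
    omega
  · exact hfree _ _ _ _ hlt ha' hbb hb' h2

/-- Steinitz bound for sequences: if `X i, Y i ∈ [1, c]` (below `p`, resp. `m`),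
`∑_{i<m} Y i = ∑_{i<p} X i + r` with `r < c`, and no interval sum `∑_{a ≤ i < a'} X i` with `a < a' ≤ p`
equals an interval sum `∑_{b ≤ i < b'} Y i` with `b ≤ b' ≤ m`, then `p + m + 1 ≤ 2 c`: the values of `s`
along the greedy chain inject `{0, …, p + m}` into the integer interval `(-c, c]`. [folklore] -/
theorem core_bound {X Y : ℕ → ℕ} {S : ℕ → ℕ → ℤ} {p m c r : ℕ}
    (hS : ∀ a b, S a b = ∑ i ∈ Finset.range b, (Y i : ℤ) - ∑ i ∈ Finset.range a, (X i : ℤ))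
    (hX : ∀ i < p, 1 ≤ X i ∧ X i ≤ c) (hY : ∀ i < m, 1 ≤ Y i ∧ Y i ≤ c)
    (hsum : ∑ i ∈ Finset.range m, Y i = ∑ i ∈ Finset.range p, X i + r) (hr : r < c)
    (hfree : ∀ a a' b b', a < a' → a' ≤ p → b ≤ b' → b' ≤ m →
      ∑ i ∈ Finset.Ico a a', X i ≠ ∑ i ∈ Finset.Ico b b', Y i) :
    p + m + 1 ≤ 2 * c := by
  -- the greedy chain, as the iterates of the step map
  obtain ⟨path, hpath0, hstep⟩ : ∃ path : ℕ → ℕ × ℕ, path 0 = (0, 0) ∧ ∀ n, path (n + 1) =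
      if S (path n).1 (path n).2 ≤ 0 then
        (if (path n).2 < m then ((path n).1, (path n).2 + 1) else ((path n).1 + 1, (path n).2))
      else (if (path n).1 < p then ((path n).1 + 1, (path n).2) else ((path n).1, (path n).2 + 1)) :=
    ⟨fun n => (fun q : ℕ × ℕ => if S q.1 q.2 ≤ 0 then (if q.2 < m then (q.1, q.2 + 1) else (q.1 + 1, q.2))
        else (if q.1 < p then (q.1 + 1, q.2) else (q.1, q.2 + 1)))^[n] (0, 0),
      rfl, fun n => Function.iterate_succ_apply' _ n _⟩
  have hmaps : Set.MapsTo (fun n => S (path n).1 (path n).2)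
      ↑(Finset.range (p + m + 1)) ↑(Finset.Ioc (-(c : ℤ)) c) := by
    intro n hn
    have hn' : n ≤ p + m := Nat.lt_succ_iff.mp (Finset.mem_range.mp (Finset.mem_coe.mp hn))
    obtain ⟨-, -, -, hlo, hhi⟩ := chain_invariant hS hX hY hsum hr hpath0 hstep n hn'
    exact Finset.mem_coe.mpr (Finset.mem_Ioc.mpr ⟨hlo, hhi⟩)
  have hinj : Set.InjOn (fun n => S (path n).1 (path n).2) ↑(Finset.range (p + m + 1)) := by
    intro n hn n' hn' heq
    have hle : n ≤ p + m := Nat.lt_succ_iff.mp (Finset.mem_range.mp (Finset.mem_coe.mp hn))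
    have hle' : n' ≤ p + m := Nat.lt_succ_iff.mp (Finset.mem_range.mp (Finset.mem_coe.mp hn'))
    by_contra hne
    rcases lt_or_gt_of_ne hne with h | h
    · exact chain_ne hS hX hY hsum hr hfree hpath0 hstep h hle' heq
    · exact chain_ne hS hX hY hsum hr hfree hpath0 hstep h hle heq.symm
  have hcard := Finset.card_le_card_of_injOn _ hmaps hinj
  rw [Finset.card_range, Int.card_Ioc] at hcard
  have h2c : ((c : ℤ) - -(c : ℤ)).toNat = 2 * c := by
    have : (c : ℤ) - -(c : ℤ) = ((2 * c : ℕ) : ℤ) := by push_cast; ring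
    rw [this, Int.toNat_natCast]
  omega

end ZeroSumFreeCardAux

/-- **Zero-sum-free exchanges are short (Steinitz bound).**  Let `x : Fin p → ℕ` and `y : Fin m → ℕ` be
weights in `[1, c]` with `∑ y = ∑ x + r`, `r < c`, such that no nonempty subfamily of the `x` has the same
total weight as a subfamily of the `y`.  Then `p + m ≤ 2 c`.  Proof: extend the weights by zero to
sequences and apply the greedy-chain bound `ZeroSumFreeCardAux.core_bound` (which even gives
`p + m + 1 ≤ 2 c`); interval subfamilies of the sequences are subfamilies of the original index types,
so zero-sum-freeness transfers. [folklore] -/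
theorem stub_zeroSumFreeCard (p m c r : ℕ) (x : Fin p → ℕ) (y : Fin m → ℕ)
    (hx : ∀ i, 1 ≤ x i ∧ x i ≤ c) (hy : ∀ i, 1 ≤ y i ∧ y i ≤ c)
    (hsum : ∑ i, y i = ∑ i, x i + r) (hr : r < c)
    (hfree : ∀ (S : Finset (Fin p)) (T : Finset (Fin m)), S.Nonempty → ∑ i ∈ S, x i ≠ ∑ i ∈ T, y i) :
    p + m ≤ 2 * c := by
  -- extend the weights by zero to sequences indexed by `ℕ`
  obtain ⟨X, hX, hXsum, hXIco⟩ := ZeroSumFreeCardAux.exists_extension p c x hx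
  obtain ⟨Y, hY, hYsum, hYIco⟩ := ZeroSumFreeCardAux.exists_extension m c y hy
  -- the lattice-path potential `s (a, b) = ∑_{i<b} Y i - ∑_{i<a} X i`
  obtain ⟨S, hS⟩ : ∃ S : ℕ → ℕ → ℤ,
      ∀ a b, S a b = ∑ i ∈ Finset.range b, (Y i : ℤ) - ∑ i ∈ Finset.range a, (X i : ℤ) :=
    ⟨_, fun _ _ => rfl⟩
  have hsum' : ∑ i ∈ Finset.range m, Y i = ∑ i ∈ Finset.range p, X i + r := by
    rw [hYsum, hXsum, hsum]
  have hfree' : ∀ a a' b b', a < a' → a' ≤ p → b ≤ b' → b' ≤ m →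
      ∑ i ∈ Finset.Ico a a', X i ≠ ∑ i ∈ Finset.Ico b b', Y i := by
    intro a a' b b' haa' ha' _ hb'
    rw [hXIco a a' ha', hYIco b b' hb']
    exact hfree _ _ ⟨⟨a, by omega⟩, Finset.mem_filter.mpr ⟨Finset.mem_univ _, le_rfl, haa'⟩⟩
  have hcore := ZeroSumFreeCardAux.core_bound hS hX hY hsum' hr hfree'
  omega

end Summit.ValiantsHypothesis.ValiantsHypothesis.Theorems.NewtonUnitEquationsNewtonTauWeak

end
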